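import Literature.AnabelianGeometry.AbsoluteAnabelian.FundamentalExtension
import Literature.IUT.HodgeTheaters.PiAvatarOrbitCategory
import HarnessLib

/-!
# Inner automorphisms act trivially on cusp sets (KIT-INSTANCE-SPEC P1 for the Π-avatar of [IUTchI] Def 6.1)

S. Mochizuki, *Inter-universal Teichmüller theory I*, kurims manuscript (May 2020), §0 «Categories» p. 33
("isomorphisms of `ℬ(Π)⁰`-objects correspond to outer isomorphisms"), Def 6.1 (iii) p. 156–157 (the set
`LabCusp^±(†𝒟_v)` of ±-label classes of cusps, on which `Aut(†𝒟_v)` acts), (v) p. 158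
(`Aut_K(X_K) ⥲ Aut_±(𝒟^{⊚±})/Aut_csp`), and *Topics in absolute anabelian geometry III*, Thm 1.9 (a) p. 37 (cusps
are recovered as conjugacy classes of decomposition groups) ([IUTchI] Def 6.1 (iii) p.156)
[claim: Mochizuki2012, status: disputed] (D-0012 claim key, series status DISPUTED — this file is pure GROUP THEORY
over abc-iut-L4-t1's `FundamentalExtension.CuspidalData` interface and abc-iut-L5-t4's orbit category
`OrbitCat`; nothing of the series is asserted and no side is taken on [IUTchIII] Cor. 3.12).

## What is proved (HOME/staging/L5/L5-t4/KIT-INSTANCE-SPEC.md §5 P1, abc-iut-L5-lead RULINGS #17 (3) / #21 (4))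

In the Π-avatar a cusp `x` of `Π` IS the `Π`-conjugacy class `decompositionClass x` of its decomposition groups
(abc-iut-L4-t1, `decompositionClass_injective`). Hence:

* (A) over `C : CuspidalData E` (ambient `Π = E.arith`): conjugation by ANY `g ∈ Π` maps `D_x` into the class of the
  SAME cusp (`conj_smul_Dcusp_mem_decompositionClass`), preserves every class
  (`conj_smul_mem_decompositionClass_iff`), and `g D_x g⁻¹` lies in the class of `y` iff `x = y`
  (`conj_smul_Dcusp_mem_decompositionClass_iff`, = `eq_of_conj` read forward); so the cusp permutation induced by
  an INNER automorphism is the identity (`eq_id_of_forall_conj_smul_Dcusp_mem`), and two group automorphisms of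
  `Π` that differ by an inner automorphism induce the SAME cusp permutation (`cuspPerm_eq_of_innerEquiv`: "any
  §6 label invariant factors through `Out`").
* (B) at the EMBEDDED / orbit-category level of `PiAvatarOrbitCategory` (design D1): for an object `A/H` and
  decomposition groups `D x ≤ A` read up to `H`-conjugacy, two normalising elements `n, m` inducing the same
  automorphism of `A/H` (`OrbitCat.autOfNormalizer_eq_iff`: `n⁻¹ m ∈ H`) move every `D x` to `H`-conjugate
  subgroups (`exists_conj_smul_eq_of_autOfNormalizer_eq`) — the cusp action of `Aut(A/H) = N_A(H)/H` on `H`-classes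
  is WELL DEFINED — and an element of `H` itself fixes every `H`-class (`exists_conj_smul_eq_of_mem`); with cusps
  distinguished by their `H`-classes the induced permutation is again the identity
  (`eq_id_of_forall_exists_conj_smul_eq`).

PROOF-ONLY: no definition, no instance, no notation; imports the two interface files only.  typed ≠ proved
elsewhere; nothing here bears on [IUTchIII] Cor. 3.12.
-/

namespace Literature.AnabelianGeometry.AbsoluteAnabelian

namespace FundamentalExtension

namespace CuspidalData

open scoped Pointwise

universe u

variable {E : FundamentalExtension.{u}} (C : CuspidalData E)

/-- Conjugating the chosen decomposition group `D_x` by ANY `g ∈ Π` stays inside the class of the same cusp `x`.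
([IUTchI] Def 6.1 (iii) p.156) [claim: Mochizuki2012, status: disputed] -/
theorem conj_smul_Dcusp_mem_decompositionClass (g : E.arith) (x : C.Cusp) :
    MulAut.conj g • C.Dcusp x ∈ C.decompositionClass x :=
  ⟨g, rfl⟩

/-- Every decomposition class is stable under conjugation: `g D g⁻¹ ∈ [D_x] ↔ D ∈ [D_x]`.
([IUTchI] Def 6.1 (iii) p.156) [claim: Mochizuki2012, status: disputed] -/
theorem conj_smul_mem_decompositionClass_iff (g : E.arith) (x : C.Cusp) (D : Subgroup E.arith) :
    MulAut.conj g • D ∈ C.decompositionClass x ↔ D ∈ C.decompositionClass x := by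
  constructor
  · rintro ⟨g', hg'⟩
    refine ⟨g⁻¹ * g', ?_⟩
    rw [map_mul, mul_smul, ← hg', map_inv, inv_smul_smul]
  · rintro ⟨g', hg'⟩
    exact ⟨g * g', by rw [hg', map_mul, mul_smul]⟩

/-- `eq_of_conj` read forward: `g D_x g⁻¹` lies in the class of the cusp `y` iff `y = x` — an inner automorphism
moves each decomposition group to a decomposition group of the SAME cusp. ([IUTchI] Def 6.1 (iii) p.156)
[claim: Mochizuki2012, status: disputed] -/
theorem conj_smul_Dcusp_mem_decompositionClass_iff (g : E.arith) (x y : C.Cusp) :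
    MulAut.conj g • C.Dcusp x ∈ C.decompositionClass y ↔ x = y := by
  constructor
  · rintro ⟨g', hg'⟩
    -- `g D_x g⁻¹ = g' D_y g'⁻¹` ⇒ `(g'⁻¹ g) D_x (g'⁻¹ g)⁻¹ = D_y`
    refine C.eq_of_conj x y (g'⁻¹ * g) ?_
    rw [map_mul, mul_smul, hg', map_inv, inv_smul_smul]
  · rintro rfl
    exact C.conj_smul_Dcusp_mem_decompositionClass g x

/-- **The cusp permutation induced by an inner automorphism is the identity**: if `σ` is any self-map of the
cusps such that `g D_x g⁻¹` is a decomposition group of `σ x` for every `x`, then `σ = id`.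
([IUTchI] Def 6.1 (iii) p.156) [claim: Mochizuki2012, status: disputed] -/
theorem eq_id_of_forall_conj_smul_Dcusp_mem (g : E.arith) (σ : C.Cusp → C.Cusp)
    (hσ : ∀ x, MulAut.conj g • C.Dcusp x ∈ C.decompositionClass (σ x)) : σ = id := by
  funext x
  exact ((C.conj_smul_Dcusp_mem_decompositionClass_iff g x (σ x)).mp (hσ x)).symm

/-- A cusp permutation read through decomposition classes is UNIQUE: if both `σ` and `τ` record, for every cusp
`x`, a class containing the image of `D_x` under the same map of subgroups, then `σ = τ`.
([AbsTopIII] Thm 1.9 (a): cusps = conjugacy classes of decomposition groups.) ([IUTchI] Def 6.1 (iii) p.156)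
[claim: Mochizuki2012, status: disputed] -/
theorem cuspPerm_unique (F : Subgroup E.arith → Subgroup E.arith) (σ τ : C.Cusp → C.Cusp)
    (hσ : ∀ x, F (C.Dcusp x) ∈ C.decompositionClass (σ x))
    (hτ : ∀ x, F (C.Dcusp x) ∈ C.decompositionClass (τ x)) : σ = τ := by
  funext x
  obtain ⟨a, ha⟩ := hσ x
  obtain ⟨b, hb⟩ := hτ x
  -- `a D_{σx} a⁻¹ = b D_{τx} b⁻¹`
  refine C.eq_of_conj (σ x) (τ x) (b⁻¹ * a) ?_
  rw [map_mul, mul_smul, ← ha, hb, map_inv, inv_smul_smul]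

/-- **Out-factorisation** ("any §6 label invariant factors through `Out`"): two group automorphisms `φ, ψ` of `Π`
that differ by an inner automorphism (`ψ = Inn(g) ∘ φ`) induce the SAME permutation of the cusps, the
permutations being read through decomposition classes. ([IUTchI] §0 p.33: isomorphisms of `ℬ(Π)⁰`-objects are
outer isomorphisms.) ([IUTchI] Def 6.1 (iii) p.156) [claim: Mochizuki2012, status: disputed] -/
theorem cuspPerm_eq_of_innerEquiv (φ ψ : E.arith ≃* E.arith) (g : E.arith)
    (hinner : ∀ a, ψ a = g * φ a * g⁻¹) (σ τ : C.Cusp → C.Cusp)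
    (hσ : ∀ x, (C.Dcusp x).map φ.toMonoidHom ∈ C.decompositionClass (σ x))
    (hτ : ∀ x, (C.Dcusp x).map ψ.toMonoidHom ∈ C.decompositionClass (τ x)) : σ = τ := by
  -- `ψ(D) = g φ(D) g⁻¹`, so `ψ(D_x)` lies in the class of `σ x` as well
  have hmap : ∀ D : Subgroup E.arith, D.map ψ.toMonoidHom = MulAut.conj g • D.map φ.toMonoidHom := by
    intro D
    ext a
    simp only [Subgroup.mem_map, MulEquiv.coe_toMonoidHom, Subgroup.mem_pointwise_smul_iff_inv_smul_mem,
      MulAut.smul_def, MulAut.conj_inv_apply]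
    constructor
    · rintro ⟨d, hd, rfl⟩
      exact ⟨d, hd, by rw [hinner]; group⟩
    · rintro ⟨d, hd, hda⟩
      refine ⟨d, hd, ?_⟩
      rw [hinner, hda]; group
  refine C.cuspPerm_unique (fun D => D.map φ.toMonoidHom) σ τ hσ fun x => ?_
  have h := hτ x
  rw [hmap] at h
  exact (C.conj_smul_mem_decompositionClass_iff g (τ x) _).mp h

end CuspidalData

end FundamentalExtension

end Literature.AnabelianGeometry.AbsoluteAnabelian

/-! ## (B) The embedded / orbit-category level -/

namespace Literature.IUT.HodgeTheaters

namespace OrbitCat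

open scoped Pointwise

universe u

variable {A : Type u} [Group A] {H : Subgroup A} {ι : Type*}

/-- An element of `H` moves every subgroup to an `H`-conjugate one (tautological form of "inner automorphisms act
trivially on `H`-classes"). ([IUTchI] Def 6.1 (iii) p.156) [claim: Mochizuki2012, status: disputed] -/
theorem exists_conj_smul_eq_of_mem {m : A} (hm : m ∈ H) (D : Subgroup A) :
    ∃ h ∈ H, MulAut.conj m • D = MulAut.conj h • D :=
  ⟨m, hm, rfl⟩

/-- **The cusp action of `Aut(A/H) = N_A(H)/H` is well defined on `H`-classes**: if two normalising elements
`n, m` induce the same automorphism of the object `A/H` (`autOfNormalizer_eq_iff`: `n⁻¹ m ∈ H`), then for every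
decomposition group `D x` the conjugates `m (D x) m⁻¹` and `n (D x) n⁻¹` are `H`-conjugate.
([IUTchI] Def 6.1 (v) p.158: `Aut_K(X_K)` acting on `LabCusp^±(𝒟^{⊚±})`.) ([IUTchI] Def 6.1 (iii) p.156)
[claim: Mochizuki2012, status: disputed] -/
theorem exists_conj_smul_eq_of_autOfNormalizer_eq {n m : A}
    (hn : n ∈ Subgroup.normalizer (H : Set A)) (hm : m ∈ Subgroup.normalizer (H : Set A))
    (he : autOfNormalizer n hn = autOfNormalizer m hm) (D : ι → Subgroup A) (x : ι) :
    ∃ h ∈ H, MulAut.conj m • D x = MulAut.conj h • (MulAut.conj n • D x) := by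
  have hk : n⁻¹ * m ∈ H := (autOfNormalizer_eq_iff hn hm).mp he
  -- `m = n k` with `k := n⁻¹ m ∈ H`; then `m D m⁻¹ = (n k n⁻¹) (n D n⁻¹) (n k n⁻¹)⁻¹` and `n k n⁻¹ ∈ H`
  refine ⟨n * (n⁻¹ * m) * n⁻¹, ?_, ?_⟩
  · rw [Subgroup.mem_normalizer_iff] at hn
    exact (hn _).mp hk
  · rw [← mul_smul, ← map_mul]
    congr 2
    group

/-- Same, for a single normalising element lying in `H`: it fixes every `H`-class (the case `n = 1`).
([IUTchI] Def 6.1 (iii) p.156) [claim: Mochizuki2012, status: disputed] -/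
theorem exists_conj_smul_eq_of_autOfNormalizer_eq_refl {m : A} (hm : m ∈ Subgroup.normalizer (H : Set A))
    (he : autOfNormalizer m hm = autOfNormalizer 1 (Subgroup.one_mem _)) (D : ι → Subgroup A) (x : ι) :
    ∃ h ∈ H, MulAut.conj m • D x = MulAut.conj h • D x := by
  obtain ⟨h, hh, hEq⟩ := exists_conj_smul_eq_of_autOfNormalizer_eq (Subgroup.one_mem _) hm he.symm D x
  exact ⟨h, hh, by simpa using hEq⟩

/-- **Inner automorphisms induce the identity on cusps (embedded form).** If the cusps `x : ι` of the object `A/H`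
are told apart by the `H`-conjugacy classes of their decomposition groups `D x` (`hinj`), then any self-map `σ` of
`ι` compatible with conjugation by an element `m ∈ H` is the identity. ([IUTchI] Def 6.1 (iii) p.156)
[claim: Mochizuki2012, status: disputed] -/
theorem eq_id_of_forall_exists_conj_smul_eq (D : ι → Subgroup A)
    (hinj : ∀ (x y : ι) (h : A), h ∈ H → MulAut.conj h • D x = D y → x = y)
    {m : A} (hm : m ∈ H) (σ : ι → ι)
    (hσ : ∀ x, ∃ h ∈ H, MulAut.conj m • D x = MulAut.conj h • D (σ x)) : σ = id := by
  funext x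
  obtain ⟨h, hh, hEq⟩ := hσ x
  -- `(h⁻¹ m) D_x (h⁻¹ m)⁻¹ = D_{σ x}` with `h⁻¹ m ∈ H`
  refine (hinj x (σ x) (h⁻¹ * m) (H.mul_mem (H.inv_mem hh) hm) ?_).symm
  rw [map_mul, mul_smul, hEq, map_inv, inv_smul_smul]

/-- The normaliser acts on `H`-classes: conjugation by `n ∈ N_A(H)` carries `H`-conjugate subgroups to
`H`-conjugate subgroups (so the class of `n D n⁻¹` depends only on the class of `D`).
([IUTchI] Def 6.1 (v) p.158) [claim: Mochizuki2012, status: disputed] -/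
theorem exists_conj_smul_eq_of_conj_smul_eq {n : A} (hn : n ∈ Subgroup.normalizer (H : Set A))
    {D D' : Subgroup A} {h : A} (hh : h ∈ H) (hD : D' = MulAut.conj h • D) :
    ∃ h' ∈ H, MulAut.conj n • D' = MulAut.conj h' • (MulAut.conj n • D) := by
  refine ⟨n * h * n⁻¹, ?_, ?_⟩
  · rw [Subgroup.mem_normalizer_iff] at hn
    exact (hn _).mp hh
  · rw [hD, ← mul_smul, ← mul_smul, ← map_mul, ← map_mul]
    congr 2
    group

end OrbitCat

end Literature.IUT.HodgeTheaters
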